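import Summits.PneNP.PneNP.Theorems.SymmetryBudgetNoHiddenOrderBranchSumHub
import Summits.PneNP.PneNP.Theorems.SymmetryBudgetNoHiddenOrderBranchSumFrozenDefs

/-!
# BranchSum VI: frozen boundaries of waiting cells (CG84-FLATNESS.md §10.1 F1–F2, §12 G0–G3)

Structural facts about refinement paths (`BranchSum.RefinementPath`, H1–H5 of CG84-FLATNESS §9.3) that
govern WAITING cells — cells staying intact over an interval of nodes — which every proof of a LINEAR
branch-sum bound (the polynomial side of the `NoHiddenOrder` / `WindowBarrier` dichotomy,
stmt-PneNP-14781 / stmt-PneNP-2145) has to use (memo §10.2, §11.4, §12).  Definitions (`IsMixed`,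
`boundary`, `hull`, `nPieces`) are in `SymmetryBudgetNoHiddenOrderBranchSumFrozenDefs.lean`.
* `mem_W_of_mixed_of_cell_eq` (**F1, freeze**): if the node-`k` cell `Y` is still a cell at node `k' ≥ k`,
  no vertex of `W k` mixed on `Y` has been removed by node `k'` (H4 read backwards);
* `mixed_iff_of_col_eq`, `mixed_symm` (**G0**): mixedness on a cell is a cell property and is symmetric
  between two cells of an equitable partition; `mixed_of_swAdj`, `exists_swAdj_of_mixed`: off the
  diagonal, switching-adjacency to a cell = being mixed on it (Fact S) — the switching-neighbourhood of
  a cell is its MIXED BOUNDARY;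
* `cell_ne_of_swAdj_of_removed` (**F2 / G1**): a cell switching-adjacent at node `j` to a vertex removed
  at `j → j+1` is not a cell at any later node (entered cells split all their switching-neighbour cells;
  a cell constant over `[j, k']` is switching-adjacent to no vertex removed in between);
* `card_touching_succ_mul_le` (**G3, service bound**): if `Y` waits over `[k, k']` and every node-`k'`
  cell has `≥ |Y|` elements (in CG84: `Y` is entered at `k'` as a smallest cell), then the transitions
  `j ∈ [k, k')` whose removed vertex `x j` is switching-adjacent to the boundary `B` of `Y` satisfy
  `(#touching + 1) · |Y| ≤ |B|` — each of them splits a cell inside `B`, `B` is retained, and at `k'`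
  the cells inside `B` have `≥ |Y|` elements; `nPieces_eq_one_of_card_lt`,
  `card_touching_eq_zero_of_card_lt` (**G2**): with `|B| < 2|Y|` the boundary is one constant cell and
  is never touched.
The removed vertices enter only through `x j ∈ W j, x j ∉ W (j+1)`; no new path hypotheses.
-/

namespace Summit.PneNP.PneNP.Theorems

open Finset

namespace BranchSum

variable {V : Type*}

/-- Not mixed means homogeneous: adjacent to all of `Y` or to none of it. -/
theorem not_isMixed_iff {G : SimpleGraph V} {v : V} {Y : Finset V} :
    ¬ IsMixed G v Y ↔ (∀ y ∈ Y, G.Adj v y) ∨ ∀ y ∈ Y, ¬ G.Adj v y := by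
  unfold IsMixed
  constructor
  · intro h; by_contra h'; push Not at h'
    exact h ⟨h'.2, h'.1⟩
  · rintro (h | h) ⟨⟨y₁, hy₁, h₁⟩, ⟨y₂, hy₂, h₂⟩⟩
    · exact h₂ (h y₂ hy₂)
    · exact h y₁ hy₁ h₁

variable [DecidableEq V] {G : SimpleGraph V} [DecidableRel G.Adj]

omit [DecidableEq V] in
/-- `IsMixed` in terms of the number of neighbours in `Y`: strictly between `0` and `|Y|`. -/
theorem isMixed_iff_card {v : V} {Y : Finset V} :
    IsMixed G v Y ↔ 0 < (Y.filter fun y => G.Adj v y).card ∧ (Y.filter fun y => G.Adj v y).card < Y.card := by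
  unfold IsMixed
  rw [card_pos, filter_nonempty_iff]
  apply and_congr Iff.rfl
  rw [← filter_ssubset (p := fun y => G.Adj v y) (s := Y)]
  constructor
  · exact card_lt_card
  · intro h
    exact Finset.ssubset_iff_subset_ne.2 ⟨filter_subset _ _, fun heq => by rw [heq] at h; exact lt_irrefl _ h⟩

variable {N : ℕ}

namespace RefinementPath

variable (R : RefinementPath G N)

/-! ### F1: the mixed boundary of a waiting cell is frozen -/

/-- **F1 (freeze).** If the node-`k` cell of `w` is still a cell (the same set) at node `k' ≥ k`, then
every vertex of `W k` that is mixed on it is still present at node `k'`. -/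
theorem mem_W_of_mixed_of_cell_eq {k k' : ℕ} (hkk' : k ≤ k') {w : V} (hw : w ∈ R.W k')
    (hcell : R.cell k' w = R.cell k w) {v : V} (hv : v ∈ R.W k) (hmix : IsMixed G v (R.cell k w)) :
    v ∈ R.W k' := by
  by_contra hv'
  rcases Nat.eq_or_lt_of_le hkk' with rfl | hlt
  · exact hv' hv
  have h : (∀ y ∈ R.cell k w, G.Adj v y) ∨ ∀ y ∈ R.cell k w, ¬ G.Adj v y := by
    rw [← hcell]; exact R.removal k k' hlt v hv hv' w hw
  exact (not_isMixed_iff.2 h) hmix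

/-! ### G0: mixedness is a cell property and is symmetric between cells -/

/-- Vertices of one cell are mixed on the same cells (equitability). -/
theorem mixed_iff_of_col_eq {k : ℕ} {u u' : V} (hu : u ∈ R.W k) (hu' : u' ∈ R.W k)
    (hcol : R.col k u = R.col k u') {w : V} (hw : w ∈ R.W k) :
    IsMixed G u (R.cell k w) ↔ IsMixed G u' (R.cell k w) := by
  rw [isMixed_iff_card, isMixed_iff_card, R.equitable k u hu u' hu' hcol w hw]

/-- **G0 (symmetry).** If `u` is mixed on the cell of `y`, then `y` is mixed on the cell of `u`
(cells of one node of an equitable partition). -/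
theorem mixed_symm {k : ℕ} {u y : V} (hu : u ∈ R.W k) (hy : y ∈ R.W k) (h : IsMixed G u (R.cell k y)) :
    IsMixed G y (R.cell k u) := by
  by_contra hny
  rcases not_isMixed_iff.1 hny with hall | hnone
  · -- `y` complete to the cell of `u`: then so is every `y'` of its cell, and `u` is not mixed
    apply (not_isMixed_iff.2 (Or.inl ?_)) h
    intro y' hy'
    have hy'W : y' ∈ R.W k := R.cell_subset_W k y hy'
    have hcnt := R.equitable k y' hy'W y hy (R.mem_cell_iff.1 hy').2 u hu
    have hfull : ((R.cell k u).filter fun t => G.Adj y t).card = (R.cell k u).card := by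
      rw [Finset.card_filter_eq_iff]; exact hall
    rw [hfull, Finset.card_filter_eq_iff] at hcnt
    exact (hcnt u (R.self_mem_cell hu)).symm
  · apply (not_isMixed_iff.2 (Or.inr ?_)) h
    intro y' hy'
    have hy'W : y' ∈ R.W k := R.cell_subset_W k y hy'
    have hcnt := R.equitable k y' hy'W y hy (R.mem_cell_iff.1 hy').2 u hu
    have hzero : ((R.cell k u).filter fun t => G.Adj y t).card = 0 := by
      rw [Finset.card_filter_eq_zero_iff]; exact hnone
    rw [hzero, Finset.card_filter_eq_zero_iff] at hcnt
    exact fun hadj => hcnt u (R.self_mem_cell hu) hadj.symm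

/-! ### Switching-adjacency to a cell = being mixed on it (off the diagonal) -/

/-- A switching-edge from `v` into a cell not containing `v` makes `v` mixed on that cell (Fact S:
switching degrees into a cell are at most half of it, so `v` cannot be homogeneous). -/
theorem mixed_of_swAdj {k : ℕ} {v y : V} (hv : v ∈ R.W k) (hy : y ∈ R.W k) (hvy : v ∉ R.cell k y)
    (h : (R.sw k).Adj v y) : IsMixed G v (R.cell k y) := by
  by_contra hn
  have hhom := not_isMixed_iff.1 hn
  have hall : R.cell k y ⊆ (R.cell k y).filter fun t => (R.sw k).Adj v t := by
    intro y' hy'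
    refine mem_filter.2 ⟨hy', R.swAdj_iff_of_homogeneous (R.mem_cell_iff.1 hy').2 ?_ ?_ h⟩
    · rintro rfl; exact hvy hy'
    · rcases hhom with hh | hh
      · exact iff_of_true (hh y' hy') (hh y (R.self_mem_cell hy))
      · exact iff_of_false (hh y' hy') (hh y (R.self_mem_cell hy))
  have h1 := card_le_card hall; have h2 := R.two_mul_swDeg_le k hv hy
  have h3 : 2 ≤ (R.cell k y).card := R.two_le k y hy
  omega

/-- Conversely, a vertex mixed on a cell not containing it has a switching-neighbour in that cell. -/
theorem exists_swAdj_of_mixed {k : ℕ} {v y : V} (hvy : v ∉ R.cell k y) (h : IsMixed G v (R.cell k y)) :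
    ∃ y' ∈ R.cell k y, (R.sw k).Adj v y' := by
  obtain ⟨⟨y₁, hy₁, h₁⟩, ⟨y₂, hy₂, h₂⟩⟩ := h
  have hc1 := swComp_congr G (W := R.W k) (u := v) rfl (R.mem_cell_iff.1 hy₁).2
  have hc2 := swComp_congr G (W := R.W k) (u := v) rfl (R.mem_cell_iff.1 hy₂).2
  by_cases hcomp : SwComp G (R.W k) (R.col k) v y
  · refine ⟨y₂, hy₂, (swGraph_adj G).2 ⟨?_, ?_⟩⟩
    · rintro rfl; exact hvy hy₂
    · exact iff_of_true (hc2.2 hcomp) h₂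
  · refine ⟨y₁, hy₁, (swGraph_adj G).2 ⟨?_, ?_⟩⟩
    · rintro rfl; exact hvy hy₁
    · exact iff_of_false (fun hc => hcomp (hc1.1 hc)) (not_not.2 h₁)

/-! ### F2 / G1: switching-neighbours of a removed vertex do not stay cells -/

/-- **F2 / G1.** If `x` is removed at `j → j+1` and is switching-adjacent at node `j` to `b`, then
for every later node `k'` still containing `b`, the node-`k'` cell of `b` is NOT its node-`j` cell:
the cell has split.  (Entered cells split all their switching-neighbour cells; a cell that stays
constant over `[j, k']` is switching-adjacent to no vertex removed in between.) -/
theorem cell_ne_of_swAdj_of_removed {j k' : ℕ} (hjk : j < k') {x b : V} (hx : x ∈ R.W j)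
    (hx' : x ∉ R.W (j + 1)) (hb : b ∈ R.W k') (hadj : (R.sw j).Adj x b) :
    R.cell k' b ≠ R.cell j b := by
  intro hcell
  have hbj : b ∈ R.W j := R.W_subset_of_le (le_of_lt hjk) hb
  have hxk' : x ∉ R.W k' := fun h => hx' (R.W_subset_of_le (Nat.succ_le_of_lt hjk) h)
  have hxb : x ∉ R.cell j b := fun h => hxk' (R.cell_subset_W k' b (by rwa [← hcell] at h))
  exact hxk' (R.mem_W_of_mixed_of_cell_eq (le_of_lt hjk) hb hcell hx (R.mixed_of_swAdj hx hbj hxb hadj))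

/-- Contrapositive form (**G1**): a cell constant over `[j, k']` has no switching-edge at node `j`
from a vertex removed at `j → j+1`. -/
theorem not_swAdj_of_removed_of_cell_eq {j k' : ℕ} (hjk : j < k') {x b : V} (hx : x ∈ R.W j)
    (hx' : x ∉ R.W (j + 1)) (hb : b ∈ R.W k') (hcell : R.cell k' b = R.cell j b) :
    ¬ (R.sw j).Adj x b :=
  fun hadj => R.cell_ne_of_swAdj_of_removed hjk hx hx' hb hadj hcell

/-! ### G3: the service bound for the boundary of a waiting cell -/

section Service

variable {k k' : ℕ} {w : V}

/-- Membership in the boundary. -/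
theorem mem_boundary_iff {v : V} : v ∈ R.boundary k w ↔ v ∈ R.W k ∧ IsMixed G v (R.cell k w) := by
  unfold boundary; exact mem_filter

/-- While `Y = cell k w` waits (is the same set at node `j ≥ k`), its boundary is retained. -/
theorem boundary_subset_W (hkj : k ≤ k') (hw : w ∈ R.W k') (hcell : R.cell k' w = R.cell k w) :
    R.boundary k w ⊆ R.W k' := fun _ hv =>
  R.mem_W_of_mixed_of_cell_eq hkj hw hcell (R.mem_boundary_iff.1 hv).1 (R.mem_boundary_iff.1 hv).2

/-- While `Y` waits, the later cells of boundary vertices stay inside the boundary. -/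
theorem cell_subset_boundary {j : ℕ} (hkj : k ≤ j) (hw : w ∈ R.W j) (hcell : R.cell j w = R.cell k w)
    {b : V} (hb : b ∈ R.boundary k w) : R.cell j b ⊆ R.boundary k w := by
  intro v hv
  have hbW : b ∈ R.W j := R.boundary_subset_W hkj hw hcell hb
  have hvW : v ∈ R.W j := R.cell_subset_W j b hv
  refine R.mem_boundary_iff.2 ⟨R.W_subset_of_le hkj hvW, ?_⟩
  have hmb : IsMixed G b (R.cell k w) := (R.mem_boundary_iff.1 hb).2
  rw [← hcell] at hmb ⊢
  exact (R.mixed_iff_of_col_eq hvW hbW (R.mem_cell_iff.1 hv).2 hw).2 hmb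

/-- The hull of a node-`(j+1)` cell is the node-`j` cell. -/
theorem hull_cell_succ {j : ℕ} {b : V} (hb : b ∈ R.W (j + 1)) : R.hull j (R.cell (j + 1) b) = R.cell j b := by
  ext v
  unfold hull
  rw [mem_filter, R.mem_cell_iff]
  constructor
  · rintro ⟨hv, z, hz, hcz⟩
    have hz' := R.mem_cell_iff.1 hz
    exact ⟨hv, hcz.trans (R.colNest j z hz'.1 b hb hz'.2)⟩
  · rintro ⟨hv, hc⟩
    exact ⟨hv, b, R.self_mem_cell hb, hc⟩

/-- **Monotonicity.** While `Y` waits, the number of cells met by its boundary does not decrease. -/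
theorem nPieces_le_succ {j : ℕ} (hkj : k ≤ j + 1) (hw : w ∈ R.W (j + 1))
    (hcell : R.cell (j + 1) w = R.cell k w) : R.nPieces k w j ≤ R.nPieces k w (j + 1) := by
  unfold nPieces
  have hB : R.boundary k w ⊆ R.W (j + 1) := R.boundary_subset_W hkj hw hcell
  have : (R.boundary k w).image (fun b => R.cell j b) =
      ((R.boundary k w).image fun b => R.cell (j + 1) b).image (R.hull j) := by
    rw [image_image]
    refine image_congr fun b hb => ?_
    simp only [Function.comp_apply]
    exact (R.hull_cell_succ (hB hb)).symm
  rw [this]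
  exact card_image_le

/-- **Strictness.** If moreover the vertex `x` removed at `j → j+1` is switching-adjacent at node `j`
to a boundary vertex, the number of cells met by the boundary strictly increases. -/
theorem nPieces_lt_succ {j : ℕ} (hkj : k ≤ j) (hw : w ∈ R.W (j + 1))
    (hcell : R.cell (j + 1) w = R.cell k w) {x : V} (hx : x ∈ R.W j) (hx' : x ∉ R.W (j + 1))
    (htouch : ∃ b ∈ R.boundary k w, (R.sw j).Adj x b) :
    R.nPieces k w j < R.nPieces k w (j + 1) := by
  obtain ⟨b₀, hb₀, hadj⟩ := htouch
  have hB : R.boundary k w ⊆ R.W (j + 1) := R.boundary_subset_W (Nat.le_succ_of_le hkj) hw hcell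
  have hb₀W : b₀ ∈ R.W (j + 1) := hB hb₀
  have hwj : w ∈ R.W j := R.nest j hw
  have hcellj : R.cell j w = R.cell k w := by
    apply Subset.antisymm
    · exact R.cell_subset_cell_of_le hkj hwj
    · rw [← hcell]; exact R.cell_subset_cell_of_le (Nat.le_succ j) hw
  -- the node-`j` cell `Z` of `b₀` splits: its node-`(j+1)` cell is a proper subset
  have hne : R.cell (j + 1) b₀ ≠ R.cell j b₀ := R.cell_ne_of_swAdj_of_removed (Nat.lt_succ_self j) hx hx' hb₀W hadj
  have hsub : R.cell (j + 1) b₀ ⊆ R.cell j b₀ := R.cell_subset_cell_of_le (Nat.le_succ j) hb₀W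
  obtain ⟨v, hvZ, hv1⟩ : ∃ v ∈ R.cell j b₀, v ∉ R.cell (j + 1) b₀ := by
    by_contra hcon; push Not at hcon; exact hne (Subset.antisymm hsub hcon)
  -- `v` is a boundary vertex as well, with a different node-`(j+1)` cell but the same node-`j` cell
  have hvB : v ∈ R.boundary k w := R.cell_subset_boundary hkj hwj hcellj hb₀ hvZ
  have hvW : v ∈ R.W (j + 1) := hB hvB
  set S := (R.boundary k w).image fun b => R.cell (j + 1) b with hS
  have hs₁ : R.cell (j + 1) b₀ ∈ S := mem_image_of_mem _ hb₀
  have hs₂ : R.cell (j + 1) v ∈ S := mem_image_of_mem _ hvB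
  have hs₁₂ : R.cell (j + 1) v ≠ R.cell (j + 1) b₀ := fun heq => hv1 (heq ▸ R.self_mem_cell hvW)
  have hhull : R.hull j (R.cell (j + 1) v) = R.hull j (R.cell (j + 1) b₀) := by
    rw [R.hull_cell_succ hvW, R.hull_cell_succ hb₀W]
    exact R.cell_eq_of_mem hvZ
  -- node-`j` pieces = hull-image of node-`(j+1)` pieces = hull-image after erasing one of the two
  have himg : (R.boundary k w).image (fun b => R.cell j b) = (S.erase (R.cell (j + 1) v)).image (R.hull j) := by
    have h1 : (R.boundary k w).image (fun b => R.cell j b) = S.image (R.hull j) := by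
      rw [hS, image_image]
      refine image_congr fun b hb => ?_
      simp only [Function.comp_apply]
      exact (R.hull_cell_succ (hB hb)).symm
    rw [h1]
    apply Subset.antisymm
    · intro Z hZ
      obtain ⟨s, hs, rfl⟩ := mem_image.1 hZ
      by_cases hsv : s = R.cell (j + 1) v
      · exact mem_image.2 ⟨R.cell (j + 1) b₀, mem_erase.2 ⟨hs₁₂.symm, hs₁⟩, by rw [hsv, hhull]⟩
      · exact mem_image.2 ⟨s, mem_erase.2 ⟨hsv, hs⟩, rfl⟩
    · exact image_subset_image (erase_subset _ _)
  unfold nPieces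
  rw [himg]
  calc ((S.erase (R.cell (j + 1) v)).image (R.hull j)).card ≤ (S.erase (R.cell (j + 1) v)).card := card_image_le
    _ < S.card := card_erase_lt_of_mem hs₂

/-- **G3 (counting form).** If `Y = cell k w` waits over `[k, k']` then the number of transitions
`j ∈ [k, k')` whose removed vertex `x j` is switching-adjacent to the boundary of `Y`, plus the number
of cells met by the boundary at node `k`, is at most the number of cells met at node `k'`. -/
theorem card_touching_add_nPieces_le (hkk' : k ≤ k') (hw : w ∈ R.W k')
    (hwait : ∀ j, k ≤ j → j ≤ k' → R.cell j w = R.cell k w) (x : ℕ → V)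
    (hx : ∀ j, k ≤ j → j < k' → x j ∈ R.W j ∧ x j ∉ R.W (j + 1)) :
    ((Ico k k').filter fun j => ∃ b ∈ R.boundary k w, (R.sw j).Adj (x j) b).card + R.nPieces k w k ≤
      R.nPieces k w k' := by
  obtain ⟨t, rfl⟩ := Nat.exists_eq_add_of_le hkk'
  induction t with
  | zero => simp
  | succ t ih =>
    have hkt : k ≤ k + t := Nat.le_add_right k t
    have hwt : w ∈ R.W (k + t + 1) := hw
    have hw' : w ∈ R.W (k + t) := R.nest _ hwt
    have ih' := ih hkt hw' (fun j hj hj' => hwait j hj (hj'.trans (Nat.le_succ _)))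
      (fun j hj hj' => hx j hj (hj'.trans (Nat.lt_succ_self _)))
    have hcell : R.cell (k + t + 1) w = R.cell k w := hwait (k + t + 1) (by omega) le_rfl
    rw [show k + (t + 1) = k + t + 1 from rfl, Nat.Ico_succ_right_eq_insert_Ico hkt, filter_insert]
    by_cases htouch : ∃ b ∈ R.boundary k w, (R.sw (k + t)).Adj (x (k + t)) b
    · rw [if_pos htouch, card_insert_of_notMem (fun h => by simp at h)]
      have hlt := R.nPieces_lt_succ hkt hwt hcell (hx (k + t) hkt (Nat.lt_succ_self _)).1
        (hx (k + t) hkt (Nat.lt_succ_self _)).2 htouch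
      omega
    · rw [if_neg htouch]
      have hle := R.nPieces_le_succ (Nat.le_succ_of_le hkt) hwt hcell
      omega

/-- At node `k'`, if every cell has at least `|Y|` elements, the boundary meets at most `|B| / |Y|`
cells: `nPieces · |Y| ≤ |B|`. -/
theorem nPieces_mul_card_le (hkk' : k ≤ k') (hw : w ∈ R.W k') (hcell : R.cell k' w = R.cell k w)
    (hmin : ∀ u ∈ R.W k', (R.cell k w).card ≤ (R.cell k' u).card) :
    R.nPieces k w k' * (R.cell k w).card ≤ (R.boundary k w).card := by
  unfold nPieces
  set S := (R.boundary k w).image fun b => R.cell k' b with hS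
  have hB : R.boundary k w ⊆ R.W k' := R.boundary_subset_W hkk' hw hcell
  have hdisj : ∀ Z ∈ S, ∀ Z' ∈ S, Z ≠ Z' → Disjoint Z Z' := by
    intro Z hZ Z' hZ' hne
    obtain ⟨b, -, rfl⟩ := mem_image.1 hZ
    obtain ⟨b', -, rfl⟩ := mem_image.1 hZ'
    exact (R.cell_eq_or_disjoint k' b b').resolve_left hne
  have hsub : S.biUnion id ⊆ R.boundary k w := by
    intro v hv
    obtain ⟨Z, hZ, hvZ⟩ := mem_biUnion.1 hv
    obtain ⟨b, hb, rfl⟩ := mem_image.1 hZ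
    exact R.cell_subset_boundary hkk' hw hcell hb hvZ
  calc S.card * (R.cell k w).card = ∑ Z ∈ S, (R.cell k w).card := by rw [sum_const, smul_eq_mul]
    _ ≤ ∑ Z ∈ S, (id Z).card := sum_le_sum fun Z hZ => by
        obtain ⟨b, hb, rfl⟩ := mem_image.1 hZ
        exact hmin b (hB hb)
    _ = (S.biUnion id).card := (card_biUnion hdisj).symm
    _ ≤ (R.boundary k w).card := card_le_card hsub

/-- A nonempty boundary meets at least one cell. -/
theorem one_le_nPieces (hB : (R.boundary k w).Nonempty) (j : ℕ) : 1 ≤ R.nPieces k w j := by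
  unfold nPieces
  exact card_pos.2 (hB.image _)

/-- **G3 (service bound).** Let `Y = cell k w` wait over `[k, k']` (the same set at every node of the
interval), let every cell of node `k'` have at least `|Y|` elements, let `x j ∈ W j ∖ W (j+1)` be the
vertices removed at the transitions `j ∈ [k, k')`, and let the boundary `B` of `Y` be nonempty.  Then
`(#{j ∈ [k,k') : x j is switching-adjacent to B} + 1) · |Y| ≤ |B|`. -/
theorem card_touching_succ_mul_le (hkk' : k ≤ k') (hw : w ∈ R.W k')
    (hwait : ∀ j, k ≤ j → j ≤ k' → R.cell j w = R.cell k w)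
    (hmin : ∀ u ∈ R.W k', (R.cell k w).card ≤ (R.cell k' u).card) (x : ℕ → V)
    (hx : ∀ j, k ≤ j → j < k' → x j ∈ R.W j ∧ x j ∉ R.W (j + 1)) (hB : (R.boundary k w).Nonempty) :
    (((Ico k k').filter fun j => ∃ b ∈ R.boundary k w, (R.sw j).Adj (x j) b).card + 1) * (R.cell k w).card ≤
      (R.boundary k w).card := by
  have h1 := R.card_touching_add_nPieces_le hkk' hw hwait x hx
  have h2 := R.nPieces_mul_card_le hkk' hw (hwait k' hkk' le_rfl) hmin; have h3 := R.one_le_nPieces hB k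
  calc (((Ico k k').filter fun j => ∃ b ∈ R.boundary k w, (R.sw j).Adj (x j) b).card + 1) * (R.cell k w).card
      ≤ R.nPieces k w k' * (R.cell k w).card := Nat.mul_le_mul_right _ (by omega)
    _ ≤ (R.boundary k w).card := h2

/-- Monotonicity over an interval: while `Y` waits over `[k, k']`, `nPieces` is non-decreasing on `[k, k']`. -/
theorem nPieces_mono (hw : w ∈ R.W k') (hwait : ∀ j, k ≤ j → j ≤ k' → R.cell j w = R.cell k w)
    {j : ℕ} (hkj : k ≤ j) (hjk : j ≤ k') : R.nPieces k w j ≤ R.nPieces k w k' := by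
  obtain ⟨t, rfl⟩ := Nat.exists_eq_add_of_le hjk
  induction t with
  | zero => exact le_rfl
  | succ t ih =>
    have hw' : w ∈ R.W (j + t) := R.nest _ hw
    have h1 := ih hw' (fun i hi hi' => hwait i hi (hi'.trans (Nat.le_succ _))) (Nat.le_add_right j t)
    have h2 := R.nPieces_le_succ (show k ≤ j + t + 1 by omega) hw (hwait (j + t + 1) (by omega) le_rfl)
    exact h1.trans h2

/-- **G2 (cheap glue is one constant cell).** If `Y` waits over `[k, k']`, every node-`k'` cell has at least
`|Y|` elements, and the boundary `B ≠ ∅` of `Y` has fewer than `2|Y|` elements, then at every node of the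
interval the boundary meets exactly one cell — it IS a single cell, constant over `[k, k']`. -/
theorem nPieces_eq_one_of_card_lt (hkk' : k ≤ k') (hw : w ∈ R.W k')
    (hwait : ∀ j, k ≤ j → j ≤ k' → R.cell j w = R.cell k w)
    (hmin : ∀ u ∈ R.W k', (R.cell k w).card ≤ (R.cell k' u).card) (hB : (R.boundary k w).Nonempty)
    (hlt : (R.boundary k w).card < 2 * (R.cell k w).card) {j : ℕ} (hkj : k ≤ j) (hjk : j ≤ k') :
    R.nPieces k w j = 1 := by
  have h1 := R.one_le_nPieces hB j; have h2 := R.nPieces_mono hw hwait hkj hjk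
  have h3 := R.nPieces_mul_card_le hkk' hw (hwait k' hkk' le_rfl) hmin
  have hY : 0 < (R.cell k w).card := card_pos.2 ⟨w, by rw [← hwait k' hkk' le_rfl]; exact R.self_mem_cell hw⟩
  have h4 : R.nPieces k w k' < 2 := by
    by_contra h; push Not at h; have := Nat.mul_le_mul_right (R.cell k w).card h; omega
  omega

/-- **G2/G3 (no service for cheap glue).** Under the hypotheses of `card_touching_succ_mul_le`, if the boundary
has fewer than `2|Y|` elements then NO transition of the wait has its removed vertex switching-adjacent to
the boundary. -/
theorem card_touching_eq_zero_of_card_lt (hkk' : k ≤ k') (hw : w ∈ R.W k')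
    (hwait : ∀ j, k ≤ j → j ≤ k' → R.cell j w = R.cell k w)
    (hmin : ∀ u ∈ R.W k', (R.cell k w).card ≤ (R.cell k' u).card) (x : ℕ → V)
    (hx : ∀ j, k ≤ j → j < k' → x j ∈ R.W j ∧ x j ∉ R.W (j + 1)) (hB : (R.boundary k w).Nonempty)
    (hlt : (R.boundary k w).card < 2 * (R.cell k w).card) :
    ((Ico k k').filter fun j => ∃ b ∈ R.boundary k w, (R.sw j).Adj (x j) b).card = 0 := by
  have h := R.card_touching_succ_mul_le hkk' hw hwait hmin x hx hB
  have hY : 0 < (R.cell k w).card := card_pos.2 ⟨w, by rw [← hwait k' hkk' le_rfl]; exact R.self_mem_cell hw⟩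
  by_contra hne
  have h1 : 1 ≤ ((Ico k k').filter fun j => ∃ b ∈ R.boundary k w, (R.sw j).Adj (x j) b).card := Nat.pos_of_ne_zero hne
  have h2 : 2 * (R.cell k w).card ≤ (((Ico k k').filter fun j => ∃ b ∈ R.boundary k w, (R.sw j).Adj (x j) b).card + 1) *
      (R.cell k w).card := Nat.mul_le_mul_right _ (by omega)
  omega

end Service

end RefinementPath

end BranchSum

end Summit.PneNP.PneNP.Theorems
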